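import Literature.MathematicalPhysics.QuantumFieldTheory.Balaban1983to89.B6Hprime2101
import Literature.MathematicalPhysics.QuantumFieldTheory.Balaban1983to89.B5Hk163Holder

/-!
# `Balaban1983to89.B6Hprime2132Holder` — T. Bałaban, *Propagators and renormalization transformations for lattice gauge
# theories. II*, Commun. Math. Phys. **96** (1984) 223–250 [Balaban1984PropagatorsII], Sect. C p. 246 (the sentence after
# (2.132)): the DERIVATIVES UP TO THIRD ORDER of `H′_j` and their HÖLDER weights — the `n`-uniform weighted alias sums of the
# (2.101)/(2.132) multipliers, and the strip regularity / exponential kernel decay of the derivative multipliers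

statement-level skeleton of published theorems with citation tags; proofs where landed; nothing here is a claim about the Yang–Mills mass gap

PDF held: `paper:balaban1984-cmp96-propagators-rt-ii` (journal page = PDF page + 222); p. 246 [PDF 24] read AS AN IMAGE on
the ×2 render `run/shared/lean/pub/pub-balaban/b2b-balaban-ref1/pages/1984-cmp96-propagators-rt-II/…-p024-x2.png`.

CITATION HEADER (lean-in-tree rule).  WHAT IS REPRODUCED: lit-balaban SKELETON row **B6.Eq2.132** ((2.132) and the sentence
after it, p. 246; until now `typed-existing (PARTIAL proof: kernel decay; derivatives ∕ Hölder absent)`: `…B6Hprime2101`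
certifies the momentum representation, the `d`-only strip, the boundedness and the exponential kernel decay of `H′_j`
itself).  THIS FILE adds the DERIVATIVE and HÖLDER half at the same (symbol) level at which the cell certified the
companion sentence of paper I for `H_k` (`…B5Hk163Holder`, B5 p. 29: *"the sum over l of the absolute value of this
expression multiplied by |∂_ν(p′+l)||p′+l|^α is bounded by a constant dependent on d only. This implies bounds on
(1/|x′−x|^α)|∂_ν(H_kB)_μ(x′) − ∂_ν(H_kB)_μ(x)|"*).  Unit `lit-balaban-r03` (B6 reader/typer and fold owner, gen 4), PHASE 2
(G.1/G.2(b)), HOME `run/shared/lean/pub/lit-balaban/`, 2026-08-21.  IMPORTS `…B6Hprime2101` (the regrouped multiplier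
`hP` = `h′_l(p′) = ū(p′+l)ρ_l(p′)²/𝒩(p′)` of (2.101), its strip tools, the engine calls) and `…B5Hk163Holder` (the weight
machinery: `norm_dC_le_omega`, `sum_norm_dC_sq_le`, `sum_omega_sq_le_W`, `rpow_half_le_sqrt163`, `cWt`,
`W_rpow_le_prod163`, `sum_prod_rpow_le163`) — all BY NAME; nothing of the tree is restated.

PRINT (p. 246 [PDF 24], verbatim): *"The operator H′_j can be investigated using the momentum representation obtained from
(2.101) [display (2.132)]. This representation together with the analyticity method described in [3] imply that
derivatives of H′_j up to third order, and their local Hölder norms as in (2.67), are uniformly bounded and have a uniform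
exponential decay with a decay rate depending on d only."*  No proof and no constants are printed.

TYPED READING (the dictionary of `…B6Hprime2101` / `…B5Hk163Holder`, `ξ = L^{−j} = 1/n`, any `n ≥ 1`).  In momentum
space `(H′_jμ)~(p′+l) = h′_l(p′)μ̃(p′)`; a fine-lattice forward derivative `∂^ξ_ν` in the fine variable multiplies the
`l`-th alias by the symbol `∂_ν(p′+l) = ξ⁻¹(e^{iξ(p′+l)_ν} − 1)` (`B5Hk163Strip.dC`), so the `m`-th derivative
`∂_{ν₁}⋯∂_{ν_m}H′_j` has the alias multipliers `Π_i ∂_{ν_i}(p′+l) · h′_l(p′)`, and — exactly as printed for `H_k` in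
paper I p. 29 — a local Hölder quotient of exponent `α` costs the extra weight `|p′+l|^α` (lattice length
`(Σ_ν|∂_ν(p′+l)|²)^{1/2}`, `B5Hk163Holder.wt163` convention).  *"derivatives … up to third order, and their local Hölder
norms … uniformly bounded"* is therefore read as the `n`-UNIFORM bound of the weighted alias sum
`Σ_l ‖h′_l(p′)‖·Π_{i≤m}‖∂_{ν_i}(p′+l)‖·(Σ_ν‖∂_ν(p′+l)‖²)^{α/2}`, `m ≤ 3`, `0 ≤ α < 1` (`weighted_alias_sum_hP_le`), on the
whole zero-free strip (hence at real momenta, `weighted_alias_sum_hP_le_real`); *"uniform exponential decay"* of the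
derivative kernels is the strip regularity of the derivative fine-offset multipliers
`G′_{a;ν₁…ν_m}(p′) = Σ_l e^{i(p′+l)·ηa} Π_i∂_{ν_i}(p′+l) h′_l(p′)` (`GHD`, `stripRegular_GHD`) fed to the b04 engine BY NAME
(`latticeKernel_GHD_decay`, `torusKernel_GHD_decay`), as `…B6Hprime2101` did for `m = 0`.  WHY `m ≤ 3` IS THE THRESHOLD:
for `l ≠ 0`, `‖h′_l‖ ≤ c·Π_ν(12/ω_n(l_ν))/W_n(l)²` (two factors `ρ_l`, each with the quadratic gain `1/W_n(l)` of
`B5Hk163Alias.norm_rho_le_W`), the weight is `O(W_n(l)^{(m+α)/2})`, and `W^{(m+α)/2−2} ≤ W^{(α−1)/2}` iff `m ≤ 3`; the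
remaining `W^{(α−1)/2}·Π(12/ω)` is summable uniformly in `n` for `α < 1` (`(24ζ(1+(1−α)/d))^d`).

WHAT IS PROVED (0 sorry, 0 new named facts; constants OURS, crude, depending on `d`, `m`, `α` only).  §1 `cHPW`,
`norm_hP_le_W` (the `W`-form bound of `h′_l`, `l ≠ 0`); §2 `wtD` (the `m`-th order weight with Hölder exponent `α`),
`wtD_le_of_ne` (`≤ 17^m·c_wt(d)·W^{(m+α)/2}`), `wtD_zero_le`; §3 `weighted_term_hP_le` (`m ≤ 3`); §4 **`weighted_alias_sum_hP_le`**
(`Σ_l ‖h′_l‖·wtD ≤ C′(d, m, α)` on `Strip d κ`, `κ ≤ κ_N(d)`, every `n ≥ 1`), `weighted_alias_sum_hP_le_real`; §5 the derivative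
fine-offset multipliers `GHD`, `GHD_tr`, `norm_GHD_le`, `differentiableAt_GHD`, **`stripRegular_GHD`** (dimension `d+1`,
`m ≤ 3`, bound `MGHD (d+1) m`), **`latticeKernel_GHD_decay`** / `torusKernel_GHD_decay` (*"uniform exponential decay with a
decay rate depending on d only"* — rate `κ_N(d+1)` of `…B6Hprime2101`).
HONEST SCOPE.  (i) As in `…B5Hk163Holder`: the passage from the weighted alias sums to the Hölder quotients of the TYPED
operator `H′_j` on `ℓ²` (Plancherel bookkeeping, B4 Lemma 2.4's argument) is left to the consumer; the constant diverges as
`α → 1`.  (ii) `|p′+l|` is the lattice length.  (iii) Orders `m ≥ 4` are not claimed (and not printed).  (iv) Value = kernel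
certificate of a located, asserted step of [Balaban1984PropagatorsII]; NOT summit progress.
-/

open scoped BigOperators Real
open Finset Complex

namespace Literature.MathematicalPhysics.QuantumFieldTheory.Balaban1983to89.B6Hprime2132Holder

open Literature.MathematicalPhysics.QuantumFieldTheory.Balaban1983to89.B4Strip
open Literature.MathematicalPhysics.QuantumFieldTheory.Balaban1983to89.B4StripCauchy
open Literature.MathematicalPhysics.QuantumFieldTheory.Balaban1983to89.B4StripSums (omega omega_pos one_le_omega
  omega_zero W W_nonneg one_le_W omega_sq_le_W)
open Literature.MathematicalPhysics.QuantumFieldTheory.Balaban1983to89.B4StripSumsDeriv (zetaS zetaS_nonneg)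
open Literature.MathematicalPhysics.QuantumFieldTheory.Balaban1983to89.B4ContourShift
open Literature.MathematicalPhysics.QuantumFieldTheory.Balaban1983to89.B4TorusKernel (descendC periodConst)
open Literature.MathematicalPhysics.QuantumFieldTheory.Balaban1983to89.B4TorusKernel.MultiPeriod (torusKernel
  torusSupNorm torusKernel_descend_decay_torusMetric)
open Literature.MathematicalPhysics.QuantumFieldTheory.Balaban1983to89.B5Strip145 (Ncal)
open Literature.MathematicalPhysics.QuantumFieldTheory.Balaban1983to89.B5Strip145Analytic
open Literature.MathematicalPhysics.QuantumFieldTheory.Balaban1983to89.B5Strip145Decay (differentiableAt_insertNth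
  tr_insertNth_left insertNth_left_mem)
open Literature.MathematicalPhysics.QuantumFieldTheory.Balaban1983to89.B5Hk163Strip
open Literature.MathematicalPhysics.QuantumFieldTheory.Balaban1983to89.B5Hk163Alias
open Literature.MathematicalPhysics.QuantumFieldTheory.Balaban1983to89.B5Hk163Decay (phase163 norm_phase163_le
  differentiable_phase163 phase163_tr)
open Literature.MathematicalPhysics.QuantumFieldTheory.Balaban1983to89.B5Hk163Holder (norm_dC_le_omega
  sum_norm_dC_sq_le sum_omega_sq_le_W cWt cWt_nonneg rpow_half_le_sqrt163 W_rpow_le_prod163 sum_prod_rpow_le163)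
open Literature.MathematicalPhysics.QuantumFieldTheory.Balaban1983to89.B6Hprime2101 (hP cHP cHP_nonneg
  norm_hP_le_decay cN_le_norm_Ncal mem_Fat_of_strip differentiableAt_hP hP_tr)

noncomputable section

variable {d : ℕ}

/-! ## §1. The `W`-form bound of `h′_l`, `l ≠ 0` (both factors `ρ_l` keep their quadratic gain) -/

section WForm

variable (n : ℕ) [NeZero n]

/-- the coefficient `c′_H(d) = (16d·64/7)²/c_N(d)` of the `W`-form bound. [folklore] -/
def cHPW (d : ℕ) : ℝ := (16 * (d : ℝ) * (64 / 7)) ^ 2 / cN163 d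

/-- `0 ≤ c′_H(d)`. [folklore] -/
private theorem cHPW_nonneg (d : ℕ) : 0 ≤ cHPW d := by
  unfold cHPW; have := cN163_pos d; positivity

/-- **`‖h′_l(p′)‖ ≤ c′_H(d)·Π_ν(12/ω_n(l_ν))/W_n(l)²`** on the zero-free strip, `l ≠ 0`, every `n ≥ 1`
(`ū` by `norm_uCbar_le_prod`, each `ρ_l` by `norm_rho_le_W`, `|𝒩| ≥ c_N`).
[cite: Balaban1984PropagatorsII, (2.101) p.241, (2.132) p.246 (text only; bound ours)] -/
theorem norm_hP_le_W {κ : ℝ} (hκ0 : 0 ≤ κ) (hκ : κ ≤ kappaN d) {p : Fin d → ℂ} (hp : p ∈ Strip d κ)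
    (k : Fin d → Fin n) (hk : k ≠ fun _ => 0) :
    ‖hP n k p‖ ≤ cHPW d * (∏ ν, 12 / omega n (k ν)) / W n k ^ 2 := by
  have hr := rOf_le d
  have hdr := d_mul_rOf_sq_le d
  have hq : p ∈ Fat d (rOf d) := mem_Fat_of_strip hκ hp
  have hN := cN_le_norm_Ncal n hκ0 hκ hp
  have hcN := cN163_pos d
  have hW1 := one_le_W n k hk
  have hW0 : 0 < W n k := by linarith
  have hA0 : 0 ≤ ∏ ν, 12 / omega n (k ν) :=
    Finset.prod_nonneg (fun ν _ => div_nonneg (by norm_num) (omega_pos n (k ν) (k ν).isLt).le)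
  have h1 := norm_uCbar_le_prod n hr hq k
  have h3 := norm_rho_le_W n hr hdr hq k hk
  have hρ0 : 0 ≤ 16 * (d : ℝ) * (64 / 7) / W n k := by positivity
  have hnum : ‖uCbar n k p * rho n k p ^ 2‖ ≤ (∏ ν, 12 / omega n (k ν)) * (16 * (d : ℝ) * (64 / 7) / W n k) ^ 2 := by
    rw [norm_mul, norm_pow]
    exact mul_le_mul h1 (pow_le_pow_left₀ (norm_nonneg _) h3 2) (sq_nonneg _) hA0
  unfold hP
  rw [norm_div]
  calc ‖uCbar n k p * rho n k p ^ 2‖ / ‖Ncal n p‖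
      ≤ ((∏ ν, 12 / omega n (k ν)) * (16 * (d : ℝ) * (64 / 7) / W n k) ^ 2) / cN163 d :=
        div_le_div₀ (mul_nonneg hA0 (sq_nonneg _)) hnum hcN hN
    _ = cHPW d * (∏ ν, 12 / omega n (k ν)) / W n k ^ 2 := by
        unfold cHPW
        field_simp

end WForm

/-! ## §2. The weight of `m` derivatives and one Hölder exponent -/

section Weight

variable (n : ℕ) [NeZero n]

/-- THE WEIGHT of the `m`-th derivative `∂_{ν₁}⋯∂_{ν_m}` with local Hölder exponent `α`:
`Π_i ‖∂_{ν_i}(p′+l)‖ · (Σ_ν ‖∂_ν(p′+l)‖²)^{α/2}` (`m = 1` is `B5Hk163Holder.wt163`).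
[cite: Balaban1984PropagatorsII, p.246 (text only; reading ours)] -/
def wtD (k : Fin d → Fin n) (p : Fin d → ℂ) {m : ℕ} (νs : Fin m → Fin d) (α : ℝ) : ℝ :=
  (∏ i, ‖dC n k p (νs i)‖) * (∑ ν', ‖dC n k p ν'‖ ^ 2) ^ (α / 2)

omit [NeZero n] in
/-- the weight is non-negative. [folklore] -/
private theorem wtD_nonneg (k : Fin d → Fin n) (p : Fin d → ℂ) {m : ℕ} (νs : Fin m → Fin d) (α : ℝ) :
    0 ≤ wtD n k p νs α :=
  mul_nonneg (Finset.prod_nonneg fun _ _ => norm_nonneg _)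
    (Real.rpow_nonneg (Finset.sum_nonneg fun _ _ => sq_nonneg _) _)

/-- `17·√(d+1) ≤ c_wt(d) = 289·√(d+1)`. [folklore] -/
private theorem seventeen_sqrt_le_cWt (d : ℕ) : 17 * Real.sqrt ((d : ℝ) + 1) ≤ cWt d := by
  unfold cWt
  have := Real.sqrt_nonneg ((d : ℝ) + 1)
  nlinarith

/-- the Hölder part of the weight: `(Σ_ν‖∂_ν(p′+l)‖²)^{α/2} ≤ 17√(d+1)·W_n(l)^{α/2}`, `l ≠ 0`, `0 ≤ α ≤ 1` (as inside
`B5Hk163Holder.wt163_le_of_ne`). [folklore] -/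
private theorem holderPart_le_of_ne {κ : ℝ} (hκ1 : κ ≤ 1) {p : Fin d → ℂ} (hp : p ∈ Strip d κ) (k : Fin d → Fin n)
    (hk : k ≠ fun _ => 0) {α : ℝ} (hα0 : 0 ≤ α) (hα1 : α ≤ 1) :
    (∑ ν', ‖dC n k p ν'‖ ^ 2) ^ (α / 2) ≤ 17 * Real.sqrt ((d : ℝ) + 1) * W n k ^ (α / 2) := by
  have hW1 := one_le_W n k hk
  have hW0 : 0 < W n k := by linarith
  have hd0 : (0 : ℝ) ≤ d := Nat.cast_nonneg d
  have hS0 : 0 ≤ ∑ ν', ‖dC n k p ν'‖ ^ 2 := Finset.sum_nonneg (fun _ _ => sq_nonneg _)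
  have hS : ∑ ν', ‖dC n k p ν'‖ ^ 2 ≤ (289 * ((d : ℝ) + 1)) * W n k := by
    have := sum_norm_dC_sq_le n hκ1 hp k
    have := sum_omega_sq_le_W n k hk
    nlinarith
  have hB1 : (1 : ℝ) ≤ 289 * ((d : ℝ) + 1) := by nlinarith
  calc (∑ ν', ‖dC n k p ν'‖ ^ 2) ^ (α / 2) ≤ ((289 * ((d : ℝ) + 1)) * W n k) ^ (α / 2) :=
        Real.rpow_le_rpow hS0 hS (by linarith)
    _ = (289 * ((d : ℝ) + 1)) ^ (α / 2) * W n k ^ (α / 2) := Real.mul_rpow (by positivity) hW0.le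
    _ ≤ Real.sqrt (289 * ((d : ℝ) + 1)) * W n k ^ (α / 2) :=
        mul_le_mul_of_nonneg_right (rpow_half_le_sqrt163 (by positivity) le_rfl hB1 hα0 hα1)
          (Real.rpow_nonneg hW0.le _)
    _ = 17 * Real.sqrt ((d : ℝ) + 1) * W n k ^ (α / 2) := by
        rw [Real.sqrt_mul (by norm_num), show (289 : ℝ) = 17 ^ 2 by norm_num, Real.sqrt_sq (by norm_num)]

/-- the derivative part of the weight: `Π_{i≤m}‖∂_{ν_i}(p′+l)‖ ≤ 17^m·W_n(l)^{m/2}`, `l ≠ 0`. [folklore] -/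
private theorem derivPart_le_of_ne {κ : ℝ} (hκ1 : κ ≤ 1) {p : Fin d → ℂ} (hp : p ∈ Strip d κ) (k : Fin d → Fin n)
    (hk : k ≠ fun _ => 0) {m : ℕ} (νs : Fin m → Fin d) :
    ∏ i, ‖dC n k p (νs i)‖ ≤ (17 : ℝ) ^ m * W n k ^ ((m : ℝ) / 2) := by
  have hW1 := one_le_W n k hk
  have hW0 : 0 < W n k := by linarith
  have h1 : ∀ i, ‖dC n k p (νs i)‖ ≤ 17 * Real.sqrt (W n k) := by
    intro i
    have h := norm_dC_le_omega n hκ1 hp k (νs i)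
    have hω : omega n (k (νs i)) ≤ Real.sqrt (W n k) := by
      rw [← Real.sqrt_sq (omega_pos n (k (νs i)) (k (νs i)).isLt).le]
      exact Real.sqrt_le_sqrt (omega_sq_le_W n k hk (νs i))
    nlinarith
  calc ∏ i, ‖dC n k p (νs i)‖ ≤ ∏ _i : Fin m, (17 * Real.sqrt (W n k)) :=
        Finset.prod_le_prod (fun i _ => norm_nonneg _) (fun i _ => h1 i)
    _ = (17 * Real.sqrt (W n k)) ^ m := by simp
    _ = (17 : ℝ) ^ m * W n k ^ ((m : ℝ) / 2) := by
        rw [mul_pow, Real.sqrt_eq_rpow, ← Real.rpow_natCast (W n k ^ ((1 : ℝ) / 2)) m,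
          ← Real.rpow_mul hW0.le]
        congr 2
        ring

/-- **THE WEIGHT IS `O(W^{(m+α)/2})`**: `wtD ≤ 17^m·c_wt(d)·W_n(l)^{(m+α)/2}` on the strip (`κ ≤ 1`), `l ≠ 0`, `0 ≤ α ≤ 1`.
[cite: Balaban1984PropagatorsII, p.246 (text only; bound ours)] -/
theorem wtD_le_of_ne {κ : ℝ} (hκ1 : κ ≤ 1) {p : Fin d → ℂ} (hp : p ∈ Strip d κ) (k : Fin d → Fin n)
    (hk : k ≠ fun _ => 0) {m : ℕ} (νs : Fin m → Fin d) {α : ℝ} (hα0 : 0 ≤ α) (hα1 : α ≤ 1) :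
    wtD n k p νs α ≤ (17 : ℝ) ^ m * cWt d * W n k ^ (((m : ℝ) + α) / 2) := by
  have hW1 := one_le_W n k hk
  have hW0 : 0 < W n k := by linarith
  have hS0 : 0 ≤ ∑ ν', ‖dC n k p ν'‖ ^ 2 := Finset.sum_nonneg (fun _ _ => sq_nonneg _)
  have h1 := derivPart_le_of_ne n hκ1 hp k hk νs
  have h2 := holderPart_le_of_ne n hκ1 hp k hk hα0 hα1
  unfold wtD
  calc (∏ i, ‖dC n k p (νs i)‖) * (∑ ν', ‖dC n k p ν'‖ ^ 2) ^ (α / 2)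
      ≤ ((17 : ℝ) ^ m * W n k ^ ((m : ℝ) / 2)) * (17 * Real.sqrt ((d : ℝ) + 1) * W n k ^ (α / 2)) :=
        mul_le_mul h1 h2 (Real.rpow_nonneg hS0 _) (by positivity)
    _ = (17 : ℝ) ^ m * (17 * Real.sqrt ((d : ℝ) + 1)) * (W n k ^ ((m : ℝ) / 2) * W n k ^ (α / 2)) := by ring
    _ ≤ (17 : ℝ) ^ m * cWt d * (W n k ^ ((m : ℝ) / 2) * W n k ^ (α / 2)) :=
        mul_le_mul_of_nonneg_right (mul_le_mul_of_nonneg_left (seventeen_sqrt_le_cWt d) (pow_nonneg (by norm_num) _))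
          (mul_nonneg (Real.rpow_nonneg hW0.le _) (Real.rpow_nonneg hW0.le _))
    _ = (17 : ℝ) ^ m * cWt d * W n k ^ (((m : ℝ) + α) / 2) := by
        rw [← Real.rpow_add hW0]; congr 1; congr 1; ring

/-- at the zero alias the weight is bounded by the constant: `wtD n 0 p′ νs α ≤ 17^m·c_wt(d)`. [folklore] -/
private theorem wtD_zero_le {κ : ℝ} (hκ1 : κ ≤ 1) {p : Fin d → ℂ} (hp : p ∈ Strip d κ) {m : ℕ} (νs : Fin m → Fin d)
    {α : ℝ} (hα0 : 0 ≤ α) (hα1 : α ≤ 1) : wtD n (fun _ => 0) p νs α ≤ (17 : ℝ) ^ m * cWt d := by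
  have hn : 1 ≤ n := Nat.one_le_iff_ne_zero.mpr (NeZero.ne n)
  have hd0 : (0 : ℝ) ≤ d := Nat.cast_nonneg d
  have h1 : ∀ i, ‖dC n (fun _ => 0) p (νs i)‖ ≤ 17 := by
    intro i
    have h := norm_dC_le_omega n hκ1 hp (fun _ => 0) (νs i)
    simp only [Fin.val_zero, omega_zero n hn, mul_one] at h
    exact h
  have hP : ∏ i, ‖dC n (fun _ => 0) p (νs i)‖ ≤ (17 : ℝ) ^ m := by
    calc ∏ i, ‖dC n (fun _ => 0) p (νs i)‖ ≤ ∏ _i : Fin m, (17 : ℝ) :=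
          Finset.prod_le_prod (fun i _ => norm_nonneg _) (fun i _ => h1 i)
      _ = (17 : ℝ) ^ m := by simp
  have hS0 : 0 ≤ ∑ ν', ‖dC n (fun _ => 0) p ν'‖ ^ 2 := Finset.sum_nonneg (fun _ _ => sq_nonneg _)
  have hS : ∑ ν', ‖dC n (fun _ => 0) p ν'‖ ^ 2 ≤ 289 * ((d : ℝ) + 1) := by
    have h := sum_norm_dC_sq_le n hκ1 hp (fun _ => 0)
    simp only [Fin.val_zero, omega_zero n hn, one_pow, Finset.sum_const, Finset.card_univ,
      Fintype.card_fin, nsmul_eq_mul, mul_one] at h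
    nlinarith
  have hB1 : (1 : ℝ) ≤ 289 * ((d : ℝ) + 1) := by nlinarith
  have h2 : (∑ ν', ‖dC n (fun _ => 0) p ν'‖ ^ 2) ^ (α / 2) ≤ 17 * Real.sqrt ((d : ℝ) + 1) := by
    calc (∑ ν', ‖dC n (fun _ => 0) p ν'‖ ^ 2) ^ (α / 2) ≤ Real.sqrt (289 * ((d : ℝ) + 1)) :=
          rpow_half_le_sqrt163 hS0 hS hB1 hα0 hα1
      _ = 17 * Real.sqrt ((d : ℝ) + 1) := by
          rw [Real.sqrt_mul (by norm_num), show (289 : ℝ) = 17 ^ 2 by norm_num, Real.sqrt_sq (by norm_num)]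
  unfold wtD
  calc (∏ i, ‖dC n (fun _ => 0) p (νs i)‖) * (∑ ν', ‖dC n (fun _ => 0) p ν'‖ ^ 2) ^ (α / 2)
      ≤ (17 : ℝ) ^ m * (17 * Real.sqrt ((d : ℝ) + 1)) :=
        mul_le_mul hP h2 (Real.rpow_nonneg hS0 _) (by positivity)
    _ ≤ (17 : ℝ) ^ m * cWt d := mul_le_mul_of_nonneg_left (seventeen_sqrt_le_cWt d) (pow_nonneg (by norm_num) _)

end Weight

/-! ## §3. The weighted alias term, `l ≠ 0`, `m ≤ 3` -/

section Term

variable (n : ℕ) [NeZero n]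

/-- **THE WEIGHTED ALIAS TERM**: for `l ≠ 0`, `m ≤ 3`, `0 ≤ α ≤ 1`,
`‖h′_l(p′)‖ · wtD ≤ c′_H·17^m·c_wt · Π_ν 12·ω_n(l_ν)^{−(1+(1−α)/d)}` — the exponent bookkeeping `(m+α)/2 − 2 ≤ (α−1)/2`.
[cite: Balaban1984PropagatorsII, p.246 (text only; bound ours)] -/
theorem weighted_term_hP_le (hd : 0 < d) {κ : ℝ} (hκ0 : 0 ≤ κ) (hκ : κ ≤ kappaN d) {p : Fin d → ℂ}
    (hp : p ∈ Strip d κ) (k : Fin d → Fin n) (hk : k ≠ fun _ => 0) {m : ℕ} (νs : Fin m → Fin d) (hm : m ≤ 3)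
    {α : ℝ} (hα0 : 0 ≤ α) (hα1 : α ≤ 1) :
    ‖hP n k p‖ * wtD n k p νs α ≤
      cHPW d * ((17 : ℝ) ^ m * cWt d) * ∏ ν, (12 * omega n (k ν) ^ (-(1 + (1 - α) / d))) := by
  have hκ1 : κ ≤ 1 := (kappa_small hκ0 (hκ.trans (kappaN_le_rOf d))).1
  have hW1 := one_le_W n k hk
  have hW0 : 0 < W n k := by linarith
  have hC0 : 0 ≤ cHPW d * ((17 : ℝ) ^ m * cWt d) :=
    mul_nonneg (cHPW_nonneg d) (mul_nonneg (pow_nonneg (by norm_num) _) (cWt_nonneg d))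
  have hA0 : 0 ≤ ∏ ν, 12 / omega n (k ν) :=
    Finset.prod_nonneg (fun ν _ => div_nonneg (by norm_num) (omega_pos n (k ν) (k ν).isLt).le)
  have hh := norm_hP_le_W n hκ0 hκ hp k hk
  have hw := wtD_le_of_ne n hκ1 hp k hk νs hα0 hα1
  have hm' : (m : ℝ) ≤ 3 := by exact_mod_cast hm
  -- the exponent bookkeeping
  have step2 : W n k ^ (((m : ℝ) + α) / 2) / W n k ^ 2 ≤ W n k ^ ((α - 1) / 2) := by
    rw [show W n k ^ 2 = W n k ^ (2 : ℝ) by norm_cast, ← Real.rpow_sub hW0]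
    exact Real.rpow_le_rpow_of_exponent_le hW1 (by linarith)
  have step3 := W_rpow_le_prod163 n hd k hk hα1
  have step4 : (∏ ν, 12 / omega n (k ν)) * (∏ ν, omega n (k ν) ^ (-((1 - α) / d))) =
      ∏ ν, (12 * omega n (k ν) ^ (-(1 + (1 - α) / d))) := by
    rw [← Finset.prod_mul_distrib]
    refine Finset.prod_congr rfl (fun ν _ => ?_)
    have hω := omega_pos n (k ν) (k ν).isLt
    rw [div_eq_mul_inv, ← Real.rpow_neg_one, mul_assoc, ← Real.rpow_add hω]
    congr 1; congr 1; ring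
  calc ‖hP n k p‖ * wtD n k p νs α
      ≤ (cHPW d * (∏ ν, 12 / omega n (k ν)) / W n k ^ 2) * ((17 : ℝ) ^ m * cWt d * W n k ^ (((m : ℝ) + α) / 2)) :=
        mul_le_mul hh hw (wtD_nonneg n k p νs α) (div_nonneg (mul_nonneg (cHPW_nonneg d) hA0) (pow_nonneg hW0.le _))
    _ = cHPW d * ((17 : ℝ) ^ m * cWt d) *
          ((∏ ν, 12 / omega n (k ν)) * (W n k ^ (((m : ℝ) + α) / 2) / W n k ^ 2)) := by ring
    _ ≤ cHPW d * ((17 : ℝ) ^ m * cWt d) * ((∏ ν, 12 / omega n (k ν)) * W n k ^ ((α - 1) / 2)) :=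
        mul_le_mul_of_nonneg_left (mul_le_mul_of_nonneg_left step2 hA0) hC0
    _ ≤ cHPW d * ((17 : ℝ) ^ m * cWt d) *
          ((∏ ν, 12 / omega n (k ν)) * ∏ ν, omega n (k ν) ^ (-((1 - α) / d))) :=
        mul_le_mul_of_nonneg_left (mul_le_mul_of_nonneg_left step3 hA0) hC0
    _ = cHPW d * ((17 : ℝ) ^ m * cWt d) * ∏ ν, (12 * omega n (k ν) ^ (-(1 + (1 - α) / d))) := by rw [step4]

/-- the zero-alias coefficient is bounded: `‖h′_0(p′)‖ ≤ c_H(d)·12^d` on the strip (`ω_n(0) = 1`). [folklore] -/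
private theorem norm_hP_zero_le (hd : 0 < d) {κ : ℝ} (hκ0 : 0 ≤ κ) (hκ : κ ≤ kappaN d) {p : Fin d → ℂ}
    (hp : p ∈ Strip d κ) : ‖hP n (fun _ => 0) p‖ ≤ cHP d * (12 : ℝ) ^ d := by
  have hn : 1 ≤ n := Nat.one_le_iff_ne_zero.mpr (NeZero.ne n)
  have h := norm_hP_le_decay n hd hκ0 hκ hp (fun _ => 0)
  simp only [Fin.val_zero, omega_zero n hn, div_one, Real.one_rpow, mul_one, Finset.prod_const,
    Finset.card_univ, Fintype.card_fin] at h
  exact h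

end Term

/-! ## §4. The `n`-uniform weighted alias sums: derivatives up to third order with a Hölder weight -/

section Main

variable (n : ℕ) [NeZero n]

/-- THE CONSTANT `C′(d, m, α) = c_H·12^d·17^m·c_wt + c′_H·17^m·c_wt·(24ζ(1+(1−α)/d))^d` (ours; `d`, `m`, `α` only;
diverges as `α → 1`). [folklore] -/
def CHolder2132 (d m : ℕ) (α : ℝ) : ℝ :=
  cHP d * (12 : ℝ) ^ d * ((17 : ℝ) ^ m * cWt d) +
    cHPW d * ((17 : ℝ) ^ m * cWt d) * (24 * zetaS (1 + (1 - α) / d)) ^ d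

/-- `0 ≤ C′(d, m, α)`. [cite: Balaban1984PropagatorsII, (2.132) p.246 (text only; constant ours)] -/
theorem CHolder2132_nonneg (d m : ℕ) (α : ℝ) : 0 ≤ CHolder2132 d m α := by
  unfold CHolder2132
  have h1 := cHP_nonneg d
  have h2 := cHPW_nonneg d
  have h3 := cWt_nonneg d
  have h4 := zetaS_nonneg (1 + (1 - α) / d)
  positivity

/-- **THE SENTENCE AFTER (2.132), SYMBOL LEVEL, CERTIFIED WITH OUR CONSTANT**: for `d ≥ 1`, every `n ≥ 1`,
`0 ≤ κ ≤ κ_N(d)`, `p′ ∈ Strip d κ`, every list of `m ≤ 3` directions and `0 ≤ α < 1`,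
`Σ_{l ∈ 2π{0,…,n−1}^d} ‖h′_l(p′)‖ · Π_{i≤m}‖∂_{ν_i}(p′+l)‖ · (Σ_ν‖∂_ν(p′+l)‖²)^{α/2} ≤ C′(d, m, α)` — *"derivatives of
H′_j up to third order, and their local Hölder norms …, are uniformly bounded"*.
[cite: Balaban1984PropagatorsII, (2.132) p.246 (text of the claim only; proof and constant ours)] -/
theorem weighted_alias_sum_hP_le (hd : 0 < d) {κ : ℝ} (hκ0 : 0 ≤ κ) (hκ : κ ≤ kappaN d) {p : Fin d → ℂ}
    (hp : p ∈ Strip d κ) {m : ℕ} (νs : Fin m → Fin d) (hm : m ≤ 3) {α : ℝ} (hα0 : 0 ≤ α) (hα1 : α < 1) :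
    ∑ k : Fin d → Fin n, ‖hP n k p‖ * wtD n k p νs α ≤ CHolder2132 d m α := by
  classical
  have hκ1 : κ ≤ 1 := (kappa_small hκ0 (hκ.trans (kappaN_le_rOf d))).1
  have he : 1 < 1 + (1 - α) / d := by
    have : (0 : ℝ) < (1 - α) / d := div_pos (by linarith) (by exact_mod_cast hd)
    linarith
  set g : (Fin d → Fin n) → ℝ := fun k => ∏ ν, (12 * omega n (k ν) ^ (-(1 + (1 - α) / d))) with hgdef
  have hg0 : ∀ k, 0 ≤ g k := fun k =>
    Finset.prod_nonneg (fun ν _ => mul_nonneg (by norm_num) (Real.rpow_nonneg (omega_pos n (k ν) (k ν).isLt).le _))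
  have hC0 : 0 ≤ cHPW d * ((17 : ℝ) ^ m * cWt d) :=
    mul_nonneg (cHPW_nonneg d) (mul_nonneg (pow_nonneg (by norm_num) _) (cWt_nonneg d))
  have hZ0 : 0 ≤ cHP d * (12 : ℝ) ^ d * ((17 : ℝ) ^ m * cWt d) :=
    mul_nonneg (mul_nonneg (cHP_nonneg d) (pow_nonneg (by norm_num) _))
      (mul_nonneg (pow_nonneg (by norm_num) _) (cWt_nonneg d))
  have hbd : ∀ k : Fin d → Fin n, ‖hP n k p‖ * wtD n k p νs α ≤
      (if k = (fun _ => 0) then cHP d * (12 : ℝ) ^ d * ((17 : ℝ) ^ m * cWt d) else 0) +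
        cHPW d * ((17 : ℝ) ^ m * cWt d) * g k := by
    intro k
    by_cases hk : k = fun _ => 0
    · rw [if_pos hk]
      subst hk
      have h1 := norm_hP_zero_le n hd hκ0 hκ hp
      have h2 := wtD_zero_le n hκ1 hp νs hα0 hα1.le
      have h3 : ‖hP n (fun _ => 0) p‖ * wtD n (fun _ => 0) p νs α ≤
          cHP d * (12 : ℝ) ^ d * ((17 : ℝ) ^ m * cWt d) :=
        mul_le_mul h1 h2 (wtD_nonneg n _ p νs α) ((norm_nonneg _).trans h1)
      have h4 : 0 ≤ cHPW d * ((17 : ℝ) ^ m * cWt d) * g (fun _ => 0) := mul_nonneg hC0 (hg0 _)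
      linarith
    · rw [if_neg hk, zero_add]
      exact weighted_term_hP_le n hd hκ0 hκ hp k hk νs hm hα0 hα1.le
  calc ∑ k : Fin d → Fin n, ‖hP n k p‖ * wtD n k p νs α
      ≤ ∑ k : Fin d → Fin n, ((if k = (fun _ => 0) then cHP d * (12 : ℝ) ^ d * ((17 : ℝ) ^ m * cWt d) else 0) +
          cHPW d * ((17 : ℝ) ^ m * cWt d) * g k) := Finset.sum_le_sum (fun k _ => hbd k)
    _ = cHP d * (12 : ℝ) ^ d * ((17 : ℝ) ^ m * cWt d) +
          cHPW d * ((17 : ℝ) ^ m * cWt d) * ∑ k : Fin d → Fin n, g k := by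
        rw [Finset.sum_add_distrib, Finset.sum_ite_eq' Finset.univ (fun _ => (0 : Fin n)),
          if_pos (Finset.mem_univ _), Finset.mul_sum]
    _ ≤ cHP d * (12 : ℝ) ^ d * ((17 : ℝ) ^ m * cWt d) +
          cHPW d * ((17 : ℝ) ^ m * cWt d) * (24 * zetaS (1 + (1 - α) / d)) ^ d := by
        have hsum : ∑ k : Fin d → Fin n, g k ≤ (24 * zetaS (1 + (1 - α) / d)) ^ d :=
          sum_prod_rpow_le163 (d := d) n he
        have := mul_le_mul_of_nonneg_left hsum hC0
        linarith
    _ = CHolder2132 d m α := rfl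

/-- **THE PRINTED SETTING (real momenta)**: for `p′ = s ∈ [−π,π]^d`, every `n ≥ 1`, `m ≤ 3` directions, `0 ≤ α < 1`:
`Σ_l ‖h′_l(s)‖·Π_i|∂_{ν_i}(s+l)|·Δ^η(s+l)^{α/2} ≤ C′(d, m, α)`. [cite: Balaban1984PropagatorsII, (2.132) p.246 (text only)] -/
theorem weighted_alias_sum_hP_le_real (hd : 0 < d) {s : Fin d → ℝ} (hs : s ∈ BZ d) {m : ℕ} (νs : Fin m → Fin d)
    (hm : m ≤ 3) {α : ℝ} (hα0 : 0 ≤ α) (hα1 : α < 1) :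
    ∑ k : Fin d → Fin n, ‖hP n k (ofRealVec s)‖ * wtD n k (ofRealVec s) νs α ≤ CHolder2132 d m α :=
  weighted_alias_sum_hP_le n hd le_rfl (kappaN_pos d).le (ofRealVec_mem_Strip le_rfl hs) νs hm hα0 hα1

end Main

/-! ## §5. The derivative fine-offset multipliers on the strip and the exponential decay of their kernels -/

section Deriv

variable (n : ℕ) [NeZero n]

/-- THE `m`-TH DERIVATIVE FINE-OFFSET MULTIPLIER of `H′_j`:
`G′_{a;ν₁…ν_m}(p′) = Σ_{l ∈ 2π{0,…,n−1}^d} e^{i(p′+l)·ηa} Π_i ∂_{ν_i}(p′+l) h′_l(p′)` — its `ℤ^d`-Fourier kernel at `y′ − y`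
is the kernel of `∂^ξ_{ν₁}⋯∂^ξ_{ν_m}H′_j` from the unit point `y` to the fine point `y′ + ηa` (each fine forward
difference of the phase produces one factor `∂_ν(p′+l)`). [cite: Balaban1984PropagatorsII, (2.132) p.246 (text only; reading ours)] -/
def GHD (a : Fin d → Fin n) {m : ℕ} (νs : Fin m → Fin d) (p : Fin d → ℂ) : ℂ :=
  ∑ k : Fin d → Fin n, phase163 n k a p * (∏ i, dC n k p (νs i)) * hP n k p

/-- SIDE PERIODICITY `G′_{a;ν}(p′ + 2πe_ν) = G′_{a;ν}(p′)` at `Re p′_ν = −π` (alias re-indexing by `σ_ν`).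
[cite: Balaban1984PropagatorsII, (2.132) p.246 (text only; construction ours)] -/
theorem GHD_tr {κ : ℝ} (hκ0 : 0 ≤ κ) (hκ : κ ≤ kappaN d) {p : Fin d → ℂ} (hp : p ∈ Strip d κ) (ν : Fin d)
    (hre : (p ν).re = -Real.pi) (a : Fin d → Fin n) {m : ℕ} (νs : Fin m → Fin d) :
    GHD n a νs (tr p ν) = GHD n a νs p := by
  unfold GHD
  have h : ∀ k : Fin d → Fin n, phase163 n k a (tr p ν) * (∏ i, dC n k (tr p ν) (νs i)) * hP n k (tr p ν) =
      phase163 n (sigma n ν k) a p * (∏ i, dC n (sigma n ν k) p (νs i)) * hP n (sigma n ν k) p := fun k => by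
    rw [phase163_tr, hP_tr n hκ0 hκ hp ν hre k]
    congr 2
    exact Finset.prod_congr rfl (fun i _ => dC_tr n k p ν (νs i))
  simp_rw [h]
  exact Equiv.sum_comp (sigmaEquiv n ν)
    (fun k => phase163 n k a p * (∏ i, dC n k p (νs i)) * hP n k p)

/-- THE STRIP BOUND `‖G′_{a;ν}(p′)‖ ≤ (e^κ)^d · C′(d, m, 0)`, uniformly in `n` and `a`, `m ≤ 3`.
[cite: Balaban1984PropagatorsII, (2.132) p.246 (text only; bound ours)] -/
theorem norm_GHD_le (hd : 0 < d) {κ : ℝ} (hκ0 : 0 ≤ κ) (hκ : κ ≤ kappaN d) {p : Fin d → ℂ} (hp : p ∈ Strip d κ)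
    (a : Fin d → Fin n) {m : ℕ} (νs : Fin m → Fin d) (hm : m ≤ 3) :
    ‖GHD n a νs p‖ ≤ Real.exp κ ^ d * CHolder2132 d m 0 := by
  have hsum := weighted_alias_sum_hP_le n hd hκ0 hκ hp νs hm le_rfl zero_lt_one
  have hwt : ∀ k : Fin d → Fin n, wtD n k p νs 0 = ∏ i, ‖dC n k p (νs i)‖ := fun k => by
    unfold wtD; rw [zero_div, Real.rpow_zero, mul_one]
  simp_rw [hwt] at hsum
  unfold GHD
  calc ‖∑ k : Fin d → Fin n, phase163 n k a p * (∏ i, dC n k p (νs i)) * hP n k p‖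
      ≤ ∑ k : Fin d → Fin n, ‖phase163 n k a p * (∏ i, dC n k p (νs i)) * hP n k p‖ := norm_sum_le _ _
    _ ≤ ∑ k : Fin d → Fin n, Real.exp κ ^ d * (‖hP n k p‖ * ∏ i, ‖dC n k p (νs i)‖) := by
        refine Finset.sum_le_sum (fun k _ => ?_)
        rw [norm_mul, norm_mul, norm_prod]
        have h1 := norm_phase163_le n hp k a
        have h0 : 0 ≤ (∏ i, ‖dC n k p (νs i)‖) * ‖hP n k p‖ :=
          mul_nonneg (Finset.prod_nonneg fun _ _ => norm_nonneg _) (norm_nonneg _)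
        calc ‖phase163 n k a p‖ * (∏ i, ‖dC n k p (νs i)‖) * ‖hP n k p‖
            = ‖phase163 n k a p‖ * ((∏ i, ‖dC n k p (νs i)‖) * ‖hP n k p‖) := by ring
          _ ≤ Real.exp κ ^ d * ((∏ i, ‖dC n k p (νs i)‖) * ‖hP n k p‖) := mul_le_mul_of_nonneg_right h1 h0
          _ = Real.exp κ ^ d * (‖hP n k p‖ * ∏ i, ‖dC n k p (νs i)‖) := by ring
    _ = Real.exp κ ^ d * ∑ k : Fin d → Fin n, ‖hP n k p‖ * ∏ i, ‖dC n k p (νs i)‖ := by rw [Finset.mul_sum]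
    _ ≤ Real.exp κ ^ d * CHolder2132 d m 0 := mul_le_mul_of_nonneg_left hsum (by positivity)

/-- HOLOMORPHY of `G′_{a;ν}` at every point of the zero-free strip («the analyticity method described in [3]»).
[cite: Balaban1984PropagatorsII, (2.132) p.246 (text only; construction ours)] -/
theorem differentiableAt_GHD {κ : ℝ} (hκ0 : 0 ≤ κ) (hκ : κ ≤ kappaN d) {p : Fin d → ℂ} (hp : p ∈ Strip d κ)
    (a : Fin d → Fin n) {m : ℕ} (νs : Fin m → Fin d) :
    DifferentiableAt ℂ (fun q : Fin d → ℂ => GHD n a νs q) p := by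
  unfold GHD
  refine DifferentiableAt.fun_sum (fun k _ => ?_)
  have h1 : DifferentiableAt ℂ (fun q : Fin d → ℂ => phase163 n k a q) p := (differentiable_phase163 n k a) p
  have h2 : DifferentiableAt ℂ (fun q : Fin d → ℂ => ∏ i, dC n k q (νs i)) p :=
    dAt_finset_prod _ _ p (fun i _ => (differentiable_dC n k (νs i)) p)
  exact (h1.mul h2).mul (differentiableAt_hP n hκ0 hκ hp k)

/-- the explicit `d`-, `m`-only strip bound `(e¹)^d · C′(d, m, 0)` (uses `κ ≤ κ_N ≤ 1`). [folklore] -/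
def MGHD (d m : ℕ) : ℝ := Real.exp 1 ^ d * CHolder2132 d m 0

/-- **STRIP REGULARITY OF THE DERIVATIVE MULTIPLIERS OF `H′_j`** on `ℂ^{d+1}`, orders `m ≤ 3`: for EVERY `n ≥ 1`, fine
offset `a`, directions `ν₁…ν_m` and `0 ≤ κ ≤ κ_N(d+1)`, `GHD n a νs` is continuous on the closed strip, holomorphic in every
coordinate slice, takes equal values on the vertical sides, and is bounded by `MGHD (d+1) m` — constants depending on the
dimension and the order only. [cite: Balaban1984PropagatorsII, p.246 (text only; construction ours)] -/
theorem stripRegular_GHD (n : ℕ) [NeZero n] {κ : ℝ} (hκ0 : 0 ≤ κ) (hκ : κ ≤ kappaN (d + 1))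
    (a : Fin (d + 1) → Fin n) {m : ℕ} (νs : Fin m → Fin (d + 1)) (hm : m ≤ 3) :
    StripRegular (d := d) (fun p : Fin (d + 1) → ℂ => GHD n a νs p) κ (MGHD (d + 1) m) := by
  have hκ1 : κ ≤ 1 := (kappa_small hκ0 (hκ.trans (kappaN_le_rOf _))).1
  have hdiffAt : ∀ p ∈ Strip (d + 1) κ, DifferentiableAt ℂ (fun q : Fin (d + 1) → ℂ => GHD n a νs q) p :=
    fun p hp => differentiableAt_GHD n hκ0 hκ hp a νs
  refine ⟨?_, ?_, ?_, ?_⟩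
  · exact fun p hp => (hdiffAt p hp).continuousAt.continuousWithinAt
  · intro i q hq z hz
    have hP : i.insertNth z (ofRealVec q) ∈ Strip (d + 1) κ :=
      insertNth_mem_Strip hκ0 i hq (openRect_subset_closedRect κ hz)
    exact ((hdiffAt _ hP).comp z (differentiableAt_insertNth i _ z)).differentiableWithinAt
  · intro i q hq y hy
    obtain ⟨hP, hre⟩ := insertNth_left_mem hκ0 i hq hy
    show GHD n a νs _ = GHD n a νs _
    rw [← tr_insertNth_left]
    exact (GHD_tr n hκ0 hκ hP i hre a νs).symm
  · intro p hp
    refine (norm_GHD_le n (Nat.succ_pos d) hκ0 hκ hp a νs hm).trans ?_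
    unfold MGHD
    have hM := CHolder2132_nonneg (d + 1) m 0
    have he : Real.exp κ ^ (d + 1) ≤ Real.exp 1 ^ (d + 1) :=
      pow_le_pow_left₀ (Real.exp_pos κ).le (Real.exp_le_exp.mpr hκ1) _
    exact mul_le_mul_of_nonneg_right he hM

/-- **«A UNIFORM EXPONENTIAL DECAY» OF THE DERIVATIVE KERNELS OF `H′_j`**, infinite lattice `ℤ^{d+1}`
(`B4ContourShift.latticeKernel_decay` by name): for every `n ≥ 1`, fine offset `a`, `m ≤ 3` directions and `x ∈ ℤ^{d+1}`,
`‖K′_{a;ν}(x)‖ ≤ MGHD(d+1, m) · e^{−κ_N(d+1)·|x|_∞}` — bound and rate depending on `d` (and the order) only.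
[cite: Balaban1984PropagatorsII, (2.132) p.246] -/
theorem latticeKernel_GHD_decay (n : ℕ) [NeZero n] (a : Fin (d + 1) → Fin n) {m : ℕ} (νs : Fin m → Fin (d + 1))
    (hm : m ≤ 3) (x : Fin (d + 1) → ℤ) :
    ‖latticeKernel (fun p : Fin (d + 1) → ℂ => GHD n a νs p) x‖ ≤
      MGHD (d + 1) m * Real.exp (-(kappaN (d + 1) * supNorm x)) :=
  latticeKernel_decay (stripRegular_GHD n (kappaN_pos _).le le_rfl a νs hm) (kappaN_pos _).le x

/-- **THE TORUS KERNELS of the derivatives of `H′_j`** (`B4TorusKernel.MultiPeriod.torusKernel_descend_decay_torusMetric` by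
name): for every period vector `N` (all `N_i ≥ 1`), `n ≥ 1`, `a`, `m ≤ 3` directions, `x`:
`‖K′_{a;ν,N}(x)‖ ≤ MGHD(d+1, m) · periodConst(κ_N(d+1), d) · e^{−(κ_N(d+1)/(d+1))·|x|_{T,∞}}`.
[cite: Balaban1984PropagatorsII, (2.132) p.246] -/
theorem torusKernel_GHD_decay (n : ℕ) [NeZero n] (a : Fin (d + 1) → Fin n) {m : ℕ} (νs : Fin m → Fin (d + 1))
    (hm : m ≤ 3) {N : Fin (d + 1) → ℕ} (hN : ∀ i, 1 ≤ N i) (x : Fin (d + 1) → ℤ) :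
    ‖torusKernel (descendC (fun p : Fin (d + 1) → ℂ => GHD n a νs p)
        (stripRegular_GHD n (kappaN_pos _).le le_rfl a νs hm) (kappaN_pos _).le) N x‖ ≤
      MGHD (d + 1) m * periodConst (kappaN (d + 1)) d *
        Real.exp (-(kappaN (d + 1) / (d + 1) * torusSupNorm N x)) :=
  torusKernel_descend_decay_torusMetric _ (kappaN_pos _) hN x

end Deriv

end

end Literature.MathematicalPhysics.QuantumFieldTheory.Balaban1983to89.B6Hprime2132Holder
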